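import Literature.Computability.Complexity.LengthCompare
import Literature.Computability.Complexity.CountingHierarchyProofs
import Literature.Computability.Complexity.PolyHierarchy
import Literature.Computability.Complexity.CoinCounting
import HarnessLib

/-!
# `NP` (and every `Σₖᵖ`) is closed under Karp reductions; `RP ⊆ NP` (proofs; trunk CplxCore)

Discharges (D-0014), with the witness-length test `LenLe p ∈ P` (`LengthCompare.lean`), the closure
of `P` under intersection (`StringCopy.lean`) and re-pairing (`MapFstMachine.lean`):

* `preimage_mem_polyExists` — **`∃·K` is closed under polynomial-time preimages** whenever `K` is
  and `K` absorbs intersections with `P` languages: for `x ∈ f⁻¹(L)` iff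
  `∃ y, |y| ≤ p(|f x|) ∧ ⟨f x, y⟩ ∈ L'`, use the witness language
  `mapFst(f)⁻¹(LenLe p ⊓ L') = {⟨x, y⟩ | |y| ≤ p(|f x|) ∧ ⟨f x, y⟩ ∈ L'}` and the bound `p(s(|x|))`
  (Arora–Barak 2009, Thm. 2.8 / Exercise 2.9, made explicit);
* `mem_NP_of_karpReducible_holds` — **discharge of `mem_NP_of_karpReducible`** (`Reductions.lean`):
  `L₁ ≤ₚ L₂ ∈ NP ⇒ L₁ ∈ NP`; `preimage_mem_NP`;
* `NP_closed_boolUnpair_fst_holds` — discharge of `AdviceBasics.NP_closed_boolUnpair_fst`, hence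
  `NP ⊆ NP/poly` unconditionally (`NP_subset_polyAdvice_NP'`);
* `preimage_mem_SigmaP`, `preimage_mem_PH` — every level of `PH`, and `PH`, is closed under Karp
  reductions;
* `P_eq_NP_of_isNPComplete_of_mem_P_holds` — discharge of `Reductions.P_eq_NP_of_isNPComplete_of_mem_P`;
* `RP_subset_NP_holds` — **discharge of `RP_subset_NP`** (`ProbabilisticClasses.lean`): the witness
  language `LenEq p ⊓ L'` (coins of the exact length; a good coin string exists since the accepting
  set has probability `≥ 1/2 > 0`) (Arora–Barak 2009, §7.3; Gill 1977, Thm. 6.5).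

## References

* S. Arora, B. Barak, *Computational Complexity: A Modern Approach*, CUP 2009, Def. 2.1, Thm. 2.8,
  Exercise 2.9, Def. 5.3, §7.3.
* J. Gill, *Computational complexity of probabilistic Turing machines*, SIAM J. Comput. 6 (1977).
-/

namespace Literature.Computability.Complexity

open _root_.Computability Polynomial

/-! ### `∃·K` is closed under polynomial-time preimages -/

/-- **The existential operator preserves closure under Karp reductions.** If `K` is closed under
`FP` preimages and `L₁ ∈ P`, `L₂ ∈ K ⇒ L₁ ⊓ L₂ ∈ K`, then `L ∈ ∃·K`, `f ∈ FP ⇒ f⁻¹(L) ∈ ∃·K`, with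
witness language `mapFst(f)⁻¹(LenLe p ⊓ L')` and bound `p ∘ s` for an output-length bound `s` of
`f`. [Arora–Barak 2009, Thm. 2.8, Exercise 2.9] [cite: AroraBarakCC2009, Thm. 2.8] -/
theorem preimage_mem_polyExists {K : Set (Language Bool)}
    (hK : ∀ ⦃L : Language Bool⦄, L ∈ K → ∀ ⦃g : List Bool → List Bool⦄, g ∈ FP → g ⁻¹' L ∈ K)
    (hKP : ∀ ⦃L₁ L₂ : Language Bool⦄, L₁ ∈ Classes.P → L₂ ∈ K → L₁ ⊓ L₂ ∈ K)
    {L : Language Bool} (hL : L ∈ polyExists K) {f : List Bool → List Bool} (hf : f ∈ FP) :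
    f ⁻¹' L ∈ polyExists K := by
  obtain ⟨L', hL', p, hp⟩ := hL
  obtain ⟨s, hs⟩ := exists_poly_length_le_of_mem_FP hf
  refine ⟨mapFstFn f ⁻¹' (LenLe p ⊓ L'), hK (hKP (LenLe_mem_P p) hL') (mapFstFn_mem_FP hf),
    p.comp s, fun x => ?_⟩
  change f x ∈ L ↔ _
  rw [hp (f x)]
  have hmem : ∀ y : List Bool, boolPair x y ∈ mapFstFn f ⁻¹' (LenLe p ⊓ L') ↔
      y.length ≤ p.eval (f x).length ∧ boolPair (f x) y ∈ L' := fun y => by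
    change mapFstFn f (boolPair x y) ∈ LenLe p ∧ mapFstFn f (boolPair x y) ∈ L' ↔ _
    rw [mapFstFn_boolPair, boolPair_mem_LenLe]
  constructor
  · rintro ⟨y, hy, hyL⟩
    refine ⟨y, hy.trans ?_, (hmem y).2 ⟨hy, hyL⟩⟩
    rw [eval_comp]
    exact TM2Iter.eval_mono p (hs x)
  · rintro ⟨y, -, hy⟩
    exact ⟨y, ((hmem y).1 hy).1, ((hmem y).1 hy).2⟩

/-- **`NP` is closed under polynomial-time preimages.** [Arora–Barak 2009, Thm. 2.8(2)] [cite: AroraBarakCC2009, Thm. 2.8] -/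
theorem preimage_mem_NP {L : Language Bool} (hL : L ∈ Nondeterministic.NP) {f : List Bool → List Bool}
    (hf : f ∈ FP) : f ⁻¹' L ∈ Nondeterministic.NP :=
  preimage_mem_polyExists (fun _ hL _ hg => preimage_mem_P hL hg) (fun _ _ h₁ h₂ => inter_mem_P h₁ h₂)
    hL hf

/-- **Discharge of `mem_NP_of_karpReducible`** (Arora–Barak 2009, Thm. 2.8(2): "if `L ≤ₚ L'` and
`L' ∈ NP` then `L ∈ NP`"). [cite: AroraBarakCC2009, Thm. 2.8] -/
theorem mem_NP_of_karpReducible_holds : mem_NP_of_karpReducible := by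
  intro L₁ L₂ h h₂
  obtain ⟨f, hf, hfL⟩ := h
  have hpre : L₁ = f ⁻¹' L₂ := Set.ext hfL
  rw [hpre]
  exact preimage_mem_NP h₂ hf

/-- **Discharge of `NP_closed_boolUnpair_fst`** (`AdviceBasics.lean`): `NP` is closed under the
first projection of the pairing (a Karp reduction, `boolUnpairFst_mem_FP`).
[cite: AroraBarakCC2009, Thm. 2.8] -/
theorem NP_closed_boolUnpair_fst_holds : NP_closed_boolUnpair_fst :=
  fun _ hL => preimage_mem_NP hL boolUnpairFst_mem_FP

/-- `NP ⊆ NP/poly`, unconditionally (`AdviceBasics.NP_subset_polyAdvice_NP` fed with the discharge).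
[Arora–Barak 2009, Def. 6.16] [cite: AroraBarakCC2009, Def. 6.16] -/
theorem NP_subset_polyAdvice_NP' : Nondeterministic.NP ⊆ polyAdvice Nondeterministic.NP :=
  NP_subset_polyAdvice_NP NP_closed_boolUnpair_fst_holds

/-! ### Intersections and unions with `P` languages, dummy witnesses -/

/-- `∃·K` absorbs intersections with `P` languages when `K` does (witness language
`{w | (boolUnpair w).1 ∈ L₁} ⊓ L'`). [Arora–Barak 2009, Def. 2.1] [folklore] -/
theorem inter_P_mem_polyExists {K : Set (Language Bool)}
    (hKP : ∀ ⦃L₁ L₂ : Language Bool⦄, L₁ ∈ Classes.P → L₂ ∈ K → L₁ ⊓ L₂ ∈ K)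
    {L₁ L₂ : Language Bool} (h₁ : L₁ ∈ Classes.P) (h₂ : L₂ ∈ polyExists K) : L₁ ⊓ L₂ ∈ polyExists K := by
  obtain ⟨L', hL', p, hp⟩ := h₂
  refine ⟨{w | (boolUnpair w).1 ∈ L₁} ⊓ L', hKP (P_closed_boolUnpair_fst L₁ h₁) hL', p, fun x => ?_⟩
  have hmem : ∀ y : List Bool, boolPair x y ∈ ({w | (boolUnpair w).1 ∈ L₁} ⊓ L' : Language Bool) ↔
      x ∈ L₁ ∧ boolPair x y ∈ L' := fun y => by
    change (boolUnpair (boolPair x y)).1 ∈ L₁ ∧ boolPair x y ∈ L' ↔ _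
    rw [boolUnpair_boolPair]
  change x ∈ L₁ ∧ x ∈ L₂ ↔ _
  rw [hp x]
  constructor
  · rintro ⟨hx, y, hy, hyL⟩
    exact ⟨y, hy, (hmem y).2 ⟨hx, hyL⟩⟩
  · rintro ⟨y, hy, hyL⟩
    exact ⟨((hmem y).1 hyL).1, y, hy, ((hmem y).1 hyL).2⟩

/-- `∃·K` absorbs unions with `P` languages when `K` does (witness language
`{w | (boolUnpair w).1 ∈ L₁} ⊔ L'`, dummy witness `[]`). [Arora–Barak 2009, Def. 2.1] [folklore] -/
theorem union_P_mem_polyExists {K : Set (Language Bool)}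
    (hKU : ∀ ⦃L₁ L₂ : Language Bool⦄, L₁ ∈ Classes.P → L₂ ∈ K → L₁ ⊔ L₂ ∈ K)
    {L₁ L₂ : Language Bool} (h₁ : L₁ ∈ Classes.P) (h₂ : L₂ ∈ polyExists K) : L₁ ⊔ L₂ ∈ polyExists K := by
  obtain ⟨L', hL', p, hp⟩ := h₂
  refine ⟨{w | (boolUnpair w).1 ∈ L₁} ⊔ L', hKU (P_closed_boolUnpair_fst L₁ h₁) hL', p, fun x => ?_⟩
  have hmem : ∀ y : List Bool, boolPair x y ∈ ({w | (boolUnpair w).1 ∈ L₁} ⊔ L' : Language Bool) ↔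
      x ∈ L₁ ∨ boolPair x y ∈ L' := fun y => by
    change (boolUnpair (boolPair x y)).1 ∈ L₁ ∨ boolPair x y ∈ L' ↔ _
    rw [boolUnpair_boolPair]
  change x ∈ L₁ ∨ x ∈ L₂ ↔ _
  rw [hp x]
  constructor
  · rintro (hx | ⟨y, hy, hyL⟩)
    · exact ⟨[], by simp, (hmem _).2 (Or.inl hx)⟩
    · exact ⟨y, hy, (hmem y).2 (Or.inr hyL)⟩
  · rintro ⟨y, hy, hyL⟩
    rcases (hmem y).1 hyL with hx | hyL
    · exact Or.inl hx
    · exact Or.inr ⟨y, hy, hyL⟩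

/-- `K ⊆ ∃·K'` by a dummy witness, whenever `{w | (boolUnpair w).1 ∈ L} ∈ K'` for `L ∈ K`.
[Bürgisser 2009, Rem. 2.2 (`K ⊆ ∃·K`)] [folklore] -/
theorem mem_polyExists_of_fst {K' : Set (Language Bool)} {L : Language Bool}
    (h : ({w | (boolUnpair w).1 ∈ L} : Language Bool) ∈ K') : L ∈ polyExists K' := by
  refine ⟨{w | (boolUnpair w).1 ∈ L}, h, 0, fun x => ?_⟩
  have hmem : ∀ y : List Bool, boolPair x y ∈ ({w | (boolUnpair w).1 ∈ L} : Language Bool) ↔ x ∈ L :=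
    fun y => by
      change (boolUnpair (boolPair x y)).1 ∈ L ↔ _
      rw [boolUnpair_boolPair]
  constructor
  · intro hx
    exact ⟨[], by simp, (hmem _).2 hx⟩
  · rintro ⟨y, -, hy⟩
    exact (hmem y).1 hy

/-! ### The levels of `PH` -/

/-- `co K` is closed under polynomial-time preimages when `K` is (`f⁻¹(Lᶜ) = (f⁻¹ L)ᶜ`). [folklore] -/
theorem preimage_mem_co {K : Set (Language Bool)}
    (hK : ∀ ⦃L : Language Bool⦄, L ∈ K → ∀ ⦃g : List Bool → List Bool⦄, g ∈ FP → g ⁻¹' L ∈ K)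
    {L : Language Bool} (hL : L ∈ co K) {f : List Bool → List Bool} (hf : f ∈ FP) :
    f ⁻¹' L ∈ co K := by
  change (f ⁻¹' L)ᶜ ∈ K
  rw [← Set.preimage_compl]
  exact hK hL hf

/-- Intersections with `P` languages stay in `co K` when unions stay in `K`. [folklore] -/
theorem inter_P_mem_co {K : Set (Language Bool)}
    (hKU : ∀ ⦃L₁ L₂ : Language Bool⦄, L₁ ∈ Classes.P → L₂ ∈ K → L₁ ⊔ L₂ ∈ K)
    {L₁ L₂ : Language Bool} (h₁ : L₁ ∈ Classes.P) (h₂ : L₂ ∈ co K) : L₁ ⊓ L₂ ∈ co K := by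
  change (L₁ ⊓ L₂)ᶜ ∈ K
  rw [compl_inf]
  exact hKU (compl_mem_P_iff.2 h₁) h₂

/-- Unions with `P` languages stay in `co K` when intersections stay in `K`. [folklore] -/
theorem union_P_mem_co {K : Set (Language Bool)}
    (hKP : ∀ ⦃L₁ L₂ : Language Bool⦄, L₁ ∈ Classes.P → L₂ ∈ K → L₁ ⊓ L₂ ∈ K)
    {L₁ L₂ : Language Bool} (h₁ : L₁ ∈ Classes.P) (h₂ : L₂ ∈ co K) : L₁ ⊔ L₂ ∈ co K := by
  change (L₁ ⊔ L₂)ᶜ ∈ K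
  rw [compl_sup]
  exact hKP (compl_mem_P_iff.2 h₁) h₂

/-- **Closure properties of `Σₖᵖ`** (simultaneous induction on `k`): closed under polynomial-time
preimages, and under intersections and unions with `P` languages. [Arora–Barak 2009, Def. 5.3, Thm. 2.8] [cite: AroraBarakCC2009, Def. 5.3] -/
theorem SigmaP_closure (k : ℕ) :
    (∀ ⦃L : Language Bool⦄, L ∈ SigmaP k → ∀ ⦃g : List Bool → List Bool⦄, g ∈ FP → g ⁻¹' L ∈ SigmaP k) ∧
    (∀ ⦃L₁ L₂ : Language Bool⦄, L₁ ∈ Classes.P → L₂ ∈ SigmaP k → L₁ ⊓ L₂ ∈ SigmaP k) ∧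
    (∀ ⦃L₁ L₂ : Language Bool⦄, L₁ ∈ Classes.P → L₂ ∈ SigmaP k → L₁ ⊔ L₂ ∈ SigmaP k) := by
  induction k with
  | zero =>
    exact ⟨fun _ hL _ hg => preimage_mem_P hL hg, fun _ _ h₁ h₂ => inter_mem_P h₁ h₂,
      fun _ _ h₁ h₂ => union_mem_P h₁ h₂⟩
  | succ k ih =>
    obtain ⟨ihp, ihi, ihu⟩ := ih
    have cop : ∀ ⦃L : Language Bool⦄, L ∈ co (SigmaP k) →
        ∀ ⦃g : List Bool → List Bool⦄, g ∈ FP → g ⁻¹' L ∈ co (SigmaP k) :=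
      fun _ hL _ hg => preimage_mem_co ihp hL hg
    have coi : ∀ ⦃L₁ L₂ : Language Bool⦄, L₁ ∈ Classes.P → L₂ ∈ co (SigmaP k) → L₁ ⊓ L₂ ∈ co (SigmaP k) :=
      fun _ _ h₁ h₂ => inter_P_mem_co ihu h₁ h₂
    have cou : ∀ ⦃L₁ L₂ : Language Bool⦄, L₁ ∈ Classes.P → L₂ ∈ co (SigmaP k) → L₁ ⊔ L₂ ∈ co (SigmaP k) :=
      fun _ _ h₁ h₂ => union_P_mem_co ihi h₁ h₂
    refine ⟨fun L hL g hg => ?_, fun L₁ L₂ h₁ h₂ => ?_, fun L₁ L₂ h₁ h₂ => ?_⟩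
    · exact preimage_mem_polyExists cop coi hL hg
    · exact inter_P_mem_polyExists coi h₁ h₂
    · exact union_P_mem_polyExists cou h₁ h₂

/-- **`Σₖᵖ` is closed under polynomial-time preimages.** [cite: AroraBarakCC2009, Def. 5.3] -/
theorem preimage_mem_SigmaP {k : ℕ} {L : Language Bool} (hL : L ∈ SigmaP k)
    {f : List Bool → List Bool} (hf : f ∈ FP) : f ⁻¹' L ∈ SigmaP k :=
  (SigmaP_closure k).1 hL hf

/-- **`Πₖᵖ` is closed under polynomial-time preimages.** [cite: AroraBarakCC2009, Def. 5.3] -/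
theorem preimage_mem_PiP {k : ℕ} {L : Language Bool} (hL : L ∈ PiP k)
    {f : List Bool → List Bool} (hf : f ∈ FP) : f ⁻¹' L ∈ PiP k :=
  preimage_mem_co (SigmaP_closure k).1 hL hf

/-- **`PH` is closed under polynomial-time preimages.** [cite: AroraBarakCC2009, Def. 5.3] -/
theorem preimage_mem_PH {L : Language Bool} (hL : L ∈ PH) {f : List Bool → List Bool}
    (hf : f ∈ FP) : f ⁻¹' L ∈ PH := by
  obtain ⟨k, hk⟩ := Set.mem_iUnion.1 hL
  exact Set.mem_iUnion.2 ⟨k, preimage_mem_SigmaP hk hf⟩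

/-- `P ⊆ Σₖᵖ` for every `k` (dummy witness; complement for the `Π`-level).
[Arora–Barak 2009, Def. 5.3] [cite: AroraBarakCC2009, Def. 5.3] -/
theorem P_subset_SigmaP (k : ℕ) : Classes.P ⊆ SigmaP k := by
  induction k with
  | zero => exact le_rfl
  | succ k ih =>
    intro L hL
    refine mem_polyExists_of_fst ?_
    change ({w | (boolUnpair w).1 ∈ L} : Language Bool)ᶜ ∈ SigmaP k
    exact ih (compl_mem_P_iff.2 (P_closed_boolUnpair_fst L hL))

/-- **Discharge of `SigmaP_subset_succ`**: `Σₖᵖ ⊆ Σₖ₊₁ᵖ` (`Σₖ₊₁ = ∃·Πₖ`; induction with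
`polyExists_mono`, base `P ⊆ Σ₁ᵖ`). [cite: AroraBarakCC2009, Def. 5.3] -/
theorem SigmaP_subset_succ_holds : SigmaP_subset_succ := by
  intro k
  induction k with
  | zero => exact P_subset_SigmaP 1
  | succ k ih =>
    change polyExists (co (SigmaP k)) ⊆ polyExists (co (SigmaP (k + 1)))
    exact polyExists_mono (co_mono ih)

/-- **Discharge of `PiP_subset_SigmaP_succ`**: `Πₖᵖ ⊆ Σₖ₊₁ᵖ = ∃·Πₖᵖ` (dummy witness; `Πₖ` is closed
under the first projection). [cite: AroraBarakCC2009, Def. 5.3] -/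
theorem PiP_subset_SigmaP_succ_holds : PiP_subset_SigmaP_succ := by
  intro k L hL
  exact mem_polyExists_of_fst (preimage_mem_PiP hL boolUnpairFst_mem_FP)

/-- **Discharge of `SigmaP_one`**: `Σ₁ᵖ = NP` (`Σ₁ = ∃·coP = ∃·P`, by `co P = P`). [cite: AroraBarakCC2009, Def. 5.3] -/
theorem SigmaP_one_holds : SigmaP_one := by
  change polyExists (co (SigmaP 0)) = polyExists Classes.P
  rw [SigmaP_zero, co_P_holds]

/-- **Discharge of `PiP_one`**: `Π₁ᵖ = coNP`. [cite: AroraBarakCC2009, Def. 5.3] -/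
theorem PiP_one_holds : PiP_one := by
  change co (SigmaP 1) = co Nondeterministic.NP
  rw [SigmaP_one_holds]

/-- **Discharge of `NP_subset_PH`**: `NP = Σ₁ᵖ ⊆ PH`. [cite: AroraBarakCC2009, Def. 5.3] -/
theorem NP_subset_PH_holds : NP_subset_PH := by
  intro L hL
  rw [← SigmaP_one_holds] at hL
  exact SigmaP_subset_PH 1 hL

/-! ### `RP ⊆ NP` -/

/-- **Discharge of `RP_subset_NP`** (Arora–Barak 2009, §7.3; Gill 1977, Thm. 6.5): for `L ∈ RP` with
witness `L' ∈ P` and coin polynomial `p`, the `NP` witness language is `LenEq p ⊓ L'` — a good coin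
string of the exact length exists when `x ∈ L` (probability `≥ 1/2 > 0`), and none exists when
`x ∉ L`. [cite: AroraBarakCC2009, §7.3] -/
theorem RP_subset_NP_holds : RP_subset_NP := by
  rintro L ⟨L', hL', p, hp⟩
  refine ⟨LenEq p ⊓ L', inter_mem_P (LenEq_mem_P p) hL', p, fun x => ?_⟩
  have hmem : ∀ y : List Bool, boolPair x y ∈ (LenEq p ⊓ L' : Language Bool) ↔
      y.length = p.eval x.length ∧ boolPair x y ∈ L' := fun y => by
    change boolPair x y ∈ LenEq p ∧ boolPair x y ∈ L' ↔ _
    rw [boolPair_mem_LenEq]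
  constructor
  · intro hx
    have hpos : 0 < uniformProb (p.eval x.length) {y : List Bool | boolPair x y ∈ L'} :=
      lt_of_lt_of_le (by norm_num) ((hp x).1 hx)
    rw [uniformProb_eq_cnt_div] at hpos
    have hcnt : 0 < cnt (p.eval x.length) {y : List Bool | boolPair x y ∈ L'} := by
      by_contra h0
      simp only [not_lt, Nat.le_zero] at h0
      rw [h0] at hpos
      simp at hpos
    obtain ⟨y, hy, hyL⟩ := (cnt_pos_iff _ _).1 hcnt
    exact ⟨y, hy.le, (hmem y).2 ⟨hy, hyL⟩⟩
  · rintro ⟨y, -, hy⟩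
    by_contra hx
    exact (hp x).2 hx y ((hmem y).1 hy).1 ((hmem y).1 hy).2


/-! ### `P = NP` from an NP-complete language in `P` -/

/-- **Discharge of `P_eq_NP_of_isNPComplete_of_mem_P`** (Arora–Barak 2009, Thm. 2.8(3)): if an
NP-complete language is in `P` then `P = NP` (`P ⊆ NP` by `P_subset_NP_holds`, `NP ⊆ P` by
`NP_subset_P_of_isNPComplete_of_mem_P`). [cite: AroraBarakCC2009, Thm. 2.8] -/
theorem P_eq_NP_of_isNPComplete_of_mem_P_holds : P_eq_NP_of_isNPComplete_of_mem_P :=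
  fun h hL => Set.Subset.antisymm P_subset_NP_holds (NP_subset_P_of_isNPComplete_of_mem_P h hL)

end Literature.Computability.Complexity
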